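import Summits.QuantumFields.BalabanUV.T4Continuum.Support.ShellMeasureLandauCorrectionB7
import Summits.QuantumFields.BalabanUV.T4Continuum.Support.ShellMeasureLandauCorrectionFromQ

/-!
# `T4Continuum.ShellMeasureLandauCorrectionReal` — row S64 f2: END-II's THIRD `Cf` binder `hCr` («`Cf` maps real fields to
# real fields») for the W-a (Cf) junction `ShellMeasureLandauCorrectionB7.landauCf` (row S64 main, leaf-10-g9 p221284):
# over a UNITARY background, [B7] Prop. 4's nonlinear part `C_k(Ū₀, ·)` sends SKEW-ADJOINT bond fields to skew-adjoint
# coarse-bond fields — from the ⋆-structure of the double-bar average ((22)–(23): `log` of a unitary is `i`·hermitian)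
(cell `pub-balaban`, `t4`, NE7c; unit `b2b-balaban-t4-ne7c-formalise-leaf-04` gen 4; owner table v2.7 row **S64 f2** (RULING
R-ne7cp1-g29-1 l.15033 «S64 is DONE when (main) lands AND `hCr` is supplied for the same `Cf`»; split ll.15113∕15163); ADDITIVE —
imports S64 (main) (leaf-10-g9) and S64b `ShellMeasureLandauCorrectionFromQ` (leaf-08-g11: `hasFDerivAt_zero_of_sq_bound`) BY
NAME; one `def` (`skewPi`), 0 `def … : Prop`, 0 sorry)

HONEST FRAMING.  Finite four-torus programme, rung (B)+1 only — NOT infinite volume, NOT a mass gap, NOT the Clay problem.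
NE7c is NOT PRINTED and NOT PROVED; «NE7c ⇐ the named binders».  END-II (`ShellMeasureLandauHolonomyPrint.slotAC_realized_su2_
landauChart_print`) displays THREE binders for `Cf V : 𝒴' → 𝒳`: `hCq`, `hCd` (row S64 main) and **`hCr : ∀ Z ∈ 𝓡𝒴', Cf V Z ∈
𝓡𝒳`** (WALL §2 (d): «the scheme maps real fields to real fields — obvious in print, displayed nowhere as a statement»).  Here
`Cf := landauCf L U₀ k S S'` in the b07 conventions: print's `U₁ = e^{iA}`, `A ∈ 𝔤 ⊂` hermitian (p. 20), the crew absorbs `i`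
(`U₁ = e^{A}`), so the REAL fields are the SKEW-ADJOINT-valued ones (`𝓡𝒴' := skewPi ↥S`, `𝓡𝒳 := skewPi ↥S'`), the background
UNITARY-valued (`B7Prop2Explicit.unitaryUnits`; `𝔸` a C⋆-algebra, `M_N(ℂ)`, `U(N) ⊃ SU(2)`).  Nothing of the manuscripts is
asserted: inputs are b07's kernel (22)–(23) `star (log u) = −log u` (`star_mlog_eq_neg`), `bavg_mem_unitaryUnits`, Prop. 2 per
level (`level_regularity`), Prop. 3's domain (`logDomainCov`), Prop. 4's bounds (`prop4_general_bounds`).  HONEST DEPENDENCY: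
continuum YM on T⁴ ⇐ BetaPertH ∧ nine spine estimates (0/9 proved); BetaPertH ⇐ (D1) ∧ (D4) ∧ CAP+tail; G-an2-4 gates asym,
D1 and NE2/3/4.

WHAT IS PROVED (kernel, no `sorry`; [folklore] = bookkeeping).  §1 `skewPi ι := AddSubgroup.pi univ (skewAdjoint 𝔸)`,
`mem_skewPi`, `isClosed_skewPi` (END-II's `h𝓡𝒳`), `real_smul_mem_skewPi`.  §2 ⋆-STRUCTURE OF (89) over a unitary background
with a skew field: `tHol_mem_unitary`, `Fcov_mem_skew`, `wframe_mem_unitary`, **`dbavgCov_mem_unitary`**, **`star_Qcov_eq_neg`**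
(`Q(V₀, A, c) = log V̿₁(c)` is SKEW on Prop. 3's domain once `‖Q‖ ≤ 1∕8`).  §3 **`logCovIter_mem_skew`** — the composite
`Q_j(U₀, ηA)` (127) is skew-valued at every `j ≤ k` for a skew initial field in Prop. 4's regime (induction; level backgrounds
unitary and regular by Prop. 2).  §4 `mem_of_hasFDerivAt_real_ray` [folklore: `Df(0)A` is the limit of real-ray difference
quotients, which stay in a closed real subgroup]; **`landauLin_mem_skewPi`** («LᵏηQ_k(U₀)A» is skew for skew `A`: it IS
`D(Q_k)(0)A` by S64b's `hasFDerivAt_zero_of_sq_bound` + S64's `norm_landauCf_le`∕`isBoundedLinearMap_landauLin`);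
**`landauCf_mem_skewPi`** — `hCr` ON THE BALL.  §5 **`landauCorrection_real_binders`** — END-II's THREE binders AT ONCE for
ONE map, the ball cut-off `(ball 0 (landauRad d L)).indicator (landauCf L U₀ k S S')` (S64b's device: `hCr` is asked for ALL
`Z ∈ 𝓡𝒴'`; off the ball the series objects are junk, so the correction is cut to `0` there — END-II evaluates `Cf` inside the
ball only): `hCq` (`C2cov d`), `hCd`, `hCr` (global), `h𝓡𝒳`.
HYPOTHESES: `2 ≤ L`; `U₀` UNITARY-valued; (52) `pdev U₀ < α₀L^{−2k}`, `0 < α₀`, `C₀(d)α₀ ≤ ⅓`, `4α₀ ≤ c₂′(d,L)`,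
`4·O1cov(d)·α₀ ≤ ⅓` (= S64 main's).  NOT DONE: `su(N)`-valuedness (tracelessness) of `C_k` (needs `Tr log = log det`,
cf. `B7Prop2SpecialUnitary`); complex backgrounds ([4] Prop. 7); W-c [dict]; NE7c NOT proved.
-/

noncomputable section
open NormedSpace Metric Set Filter Topology

namespace Summit.QuantumFields.BalabanUV.T4Continuum.ShellMeasureLandauCorrectionReal

open Literature.MathematicalPhysics.QuantumFieldTheory.Balaban1983to89
open B7Prop1Explicit (Site hol Wcx boxVec bavg expUnit val_expUnit U1 treeWord e)
open B7Prop2Explicit (avgIter pdev C0 c2' unitaryUnits mem_unitaryUnits unitaryUnits_le_U1 avgClosed_unitaryUnits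
  star_mlog_eq_neg bavg_mem_unitaryUnits hol_mem_of)
open B7Prop3Flat (c3 c3_pos expCfg insCfg)
open B7Prop3GeneralLinear (Qcov)
open B7Prop3GeneralAnalytic (logDomainCov)
open B7Eq92Concrete (Rc Rc_apply tHol Fcov wframe tild tild_apply dbavgCov dbavgCov_apply)
open B7Prop4GeneralLevels (logCovIter logCovIter_zero logCovIter_succ level_regularity)
open MatrixLog (mlog exp_mlog)
open ShellMeasureAverageProp4General (C1cov O1cov C2cov C1cov_pos O1cov_pos two_mul_le_betaMax prop4_general_bounds
  smallness_of_bracket)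
open ShellMeasureAverageProp3Discharge (loopReg_of_pdev)
open ShellMeasureLandauCorrectionB7 (landauRad scaleIns landauLin landauCf landauRad_pos norm_scaleIns_le pow_mul_inv_mul
  bracket_of_le_landauRad isBoundedLinearMap_landauLin norm_landauCf_le differentiableOn_landauCf)
open ShellMeasureLandauCorrectionFromQ (hasFDerivAt_zero_of_sq_bound)

variable {d : ℕ}

section Skew

variable {𝔸 : Type*} [CStarAlgebra 𝔸]

/-- **THE REAL STRUCTURE** on a space of bond functions `ι → 𝔸`: every value skew-adjoint (`star x = −x`; the crew's `A`
absorbs print's `i`, p. 20 «U = e^{iA}, A ∈ 𝔤», `𝔤 ⊂` hermitian matrices). [cite: Balaban1985Averaging, p.20] -/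
def skewPi (ι : Type*) : AddSubgroup (ι → 𝔸) := AddSubgroup.pi Set.univ fun _ => skewAdjoint 𝔸

/-- membership in `skewPi` is coordinatewise skew-adjointness. [folklore] -/
theorem mem_skewPi {ι : Type*} {Z : ι → 𝔸} : Z ∈ skewPi ι ↔ ∀ i, star (Z i) = -Z i := by
  simp only [skewPi, AddSubgroup.mem_pi, Set.mem_univ, true_implies, skewAdjoint.mem_iff]

/-- the skew-adjoint elements form a closed set. [folklore] -/
theorem isClosed_skewAdjoint : IsClosed (skewAdjoint 𝔸 : Set 𝔸) := by
  have h : (skewAdjoint 𝔸 : Set 𝔸) = {x | star x = -x} := Set.ext fun x => skewAdjoint.mem_iff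
  rw [h]
  exact isClosed_eq continuous_star continuous_neg

/-- `skewPi` is closed (END-II's `h𝓡𝒳`). [folklore] -/
theorem isClosed_skewPi (ι : Type*) : IsClosed ((skewPi (𝔸 := 𝔸) ι : AddSubgroup (ι → 𝔸)) : Set (ι → 𝔸)) := by
  rw [skewPi, AddSubgroup.coe_pi]
  exact isClosed_set_pi fun i _ => isClosed_skewAdjoint

/-- real (complex-typed) scalars preserve skew-adjointness. [folklore] -/
theorem real_smul_mem_skewAdjoint (r : ℝ) {x : 𝔸} (hx : x ∈ skewAdjoint 𝔸) : (r : ℂ) • x ∈ skewAdjoint 𝔸 := by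
  rw [Complex.coe_smul]
  exact skewAdjoint.smul_mem r hx

/-- … coordinatewise. [folklore] -/
theorem real_smul_mem_skewPi {ι : Type*} (r : ℝ) {Z : ι → 𝔸} (hZ : Z ∈ skewPi ι) : (r : ℂ) • Z ∈ skewPi ι := by
  rw [mem_skewPi] at hZ ⊢
  intro i
  have h := real_smul_mem_skewAdjoint r (skewAdjoint.mem_iff.2 (hZ i))
  rw [skewAdjoint.mem_iff] at h
  simpa only [Pi.smul_apply] using h

/-- `exp` of a skew-adjoint element is unitary ((22)–(23) read backwards; Mathlib). [cite: Balaban1985Averaging, (22)–(23) p.21] -/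
theorem exp_mem_unitary_of_skew {X : 𝔸} (hX : star X = -X) : exp X ∈ unitary 𝔸 := by
  letI : NormedAlgebra ℚ 𝔸 := NormedAlgebra.restrictScalars ℚ ℂ 𝔸
  exact NormedSpace.exp_mem_unitary_of_mem_skewAdjoint (skewAdjoint.mem_iff.2 hX)

end Skew

section DoubleBar

variable {𝔸 : Type*} [CStarAlgebra 𝔸] {L : ℕ}

/-- `e^{A}V₀` is unitary-valued for a skew field `A` and a unitary `V₀`. [cite: Balaban1985Averaging, (109) p.34] -/
theorem expCfg_mul_mem_unitary {V₀ : Site d → Fin d → 𝔸ˣ} (hV₀ : ∀ x κ, V₀ x κ ∈ unitaryUnits 𝔸)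
    {A : Site d → Fin d → 𝔸} (hAs : ∀ x κ, star (A x κ) = -A x κ) (x : Site d) (κ : Fin d) :
    (expCfg A * V₀) x κ ∈ unitaryUnits 𝔸 := by
  rw [Pi.mul_apply]
  refine (unitaryUnits 𝔸).mul_mem ?_ (hV₀ x κ)
  rw [mem_unitaryUnits]
  exact exp_mem_unitary_of_skew (hAs x κ)

/-- the twisted holonomy (58) `(R_{0,y}V₁)(Γ) = (V₁V₀)(Γ)V₀(Γ)⁻¹` is unitary. [cite: Balaban1985Averaging, (58) p.27] -/
theorem tHol_mem_unitary {V₀ V₁ : Site d → Fin d → 𝔸ˣ} (hV₀ : ∀ x κ, V₀ x κ ∈ unitaryUnits 𝔸)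
    (hV₁₀ : ∀ x κ, (V₁ * V₀) x κ ∈ unitaryUnits 𝔸) (y : Site d) (w : List (B7Prop1Explicit.Letter d)) :
    tHol V₀ V₁ y w ∈ unitaryUnits 𝔸 :=
  (unitaryUnits 𝔸).mul_mem (hol_mem_of hV₁₀ y w) ((unitaryUnits 𝔸).inv_mem (hol_mem_of hV₀ y w))

/-- the frame exponent `F(y)` (62)∕(110) is SKEW when the twisted tree holonomies are unitary and within `1∕4` of `1`
(a real average of skew logarithms, (22)–(23)). [cite: Balaban1985Averaging, (110) p.34, (22)–(23) p.21] -/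
theorem Fcov_mem_skew {V₀ V₁ : Site d → Fin d → 𝔸ˣ} (y : Site d)
    (hunit : ∀ r : Fin d → Fin L, tHol V₀ V₁ y (treeWord (boxVec L r)) ∈ unitaryUnits 𝔸)
    (h4 : ∀ r : Fin d → Fin L, ‖((tHol V₀ V₁ y (treeWord (boxVec L r)) : 𝔸ˣ) : 𝔸) - 1‖ ≤ 1 / 4) :
    Fcov L V₀ V₁ y ∈ skewAdjoint 𝔸 := by
  unfold Fcov
  refine AddSubmonoid.sum_mem _ fun r _ => skewAdjoint.smul_mem _ ?_
  rw [skewAdjoint.mem_iff]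
  exact star_mlog_eq_neg (hunit r) (h4 r)

/-- … so the frame `\overline{R_{0,y}V₁} = e^{F(y)}` is unitary. [cite: Balaban1985Averaging, (110) p.34] -/
theorem wframe_mem_unitary {V₀ V₁ : Site d → Fin d → 𝔸ˣ} (y : Site d)
    (hunit : ∀ r : Fin d → Fin L, tHol V₀ V₁ y (treeWord (boxVec L r)) ∈ unitaryUnits 𝔸)
    (h4 : ∀ r : Fin d → Fin L, ‖((tHol V₀ V₁ y (treeWord (boxVec L r)) : 𝔸ˣ) : 𝔸) - 1‖ ≤ 1 / 4) :
    wframe L V₀ V₁ y ∈ unitaryUnits 𝔸 := by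
  rw [mem_unitaryUnits, wframe, val_expUnit]
  exact exp_mem_unitary_of_skew (skewAdjoint.mem_iff.1 (Fcov_mem_skew y hunit h4))

/-- **THE DOUBLE-BAR AVERAGE (89) OF A SKEW FIELD OVER A UNITARY BACKGROUND IS UNITARY**: frames, tilde (65) and the rotation
`R̄_{0,c}` (59) are unitary once the log-arguments are within `1∕4` of `1`. [cite: Balaban1985Averaging, (89) p.31, (65) p.29, (59) p.27] -/
theorem dbavgCov_mem_unitary {V₀ : Site d → Fin d → 𝔸ˣ} (hV₀ : ∀ x κ, V₀ x κ ∈ unitaryUnits 𝔸)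
    {A : Site d → Fin d → 𝔸} (hAs : ∀ x κ, star (A x κ) = -A x κ) (q : Site d) (κ : Fin d)
    (hW : ∀ r : Fin d → Fin L, ‖((Wcx L (expCfg A * V₀) q κ (boxVec L r) : 𝔸ˣ) : 𝔸) - 1‖ ≤ 1 / 4)
    (hT₁ : ∀ r : Fin d → Fin L, ‖((tHol V₀ (expCfg A) q (treeWord (boxVec L r)) : 𝔸ˣ) : 𝔸) - 1‖ ≤ 1 / 4)
    (hT₂ : ∀ r : Fin d → Fin L,
      ‖((tHol V₀ (expCfg A) (q + (L : ℤ) • e κ) (treeWord (boxVec L r)) : 𝔸ˣ) : 𝔸) - 1‖ ≤ 1 / 4)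
    (hreg : ∀ r : Fin d → Fin L, ‖((Wcx L V₀ q κ (boxVec L r) : 𝔸ˣ) : 𝔸) - 1‖ ≤ 1 / 4) :
    dbavgCov L V₀ (expCfg A) q κ ∈ unitaryUnits 𝔸 := by
  have hV₁₀ := expCfg_mul_mem_unitary hV₀ hAs
  have hT : ∀ y w, tHol V₀ (expCfg A) y w ∈ unitaryUnits 𝔸 := tHol_mem_unitary hV₀ hV₁₀
  have hf₁ := wframe_mem_unitary (L := L) q (fun r => hT _ _) hT₁
  have hf₂ := wframe_mem_unitary (L := L) (q + (L : ℤ) • e κ) (fun r => hT _ _) hT₂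
  have hb₀ := bavg_mem_unitaryUnits hV₀ L q κ hreg
  have hb₁ := bavg_mem_unitaryUnits hV₁₀ L q κ hW
  rw [dbavgCov_apply, tild_apply, Rc_apply]
  refine (unitaryUnits 𝔸).mul_mem ((unitaryUnits 𝔸).mul_mem ((unitaryUnits 𝔸).inv_mem hf₁)
    ((unitaryUnits 𝔸).mul_mem hb₁ ((unitaryUnits 𝔸).inv_mem hb₀))) ?_
  exact (unitaryUnits 𝔸).mul_mem ((unitaryUnits 𝔸).mul_mem hb₀ hf₂) ((unitaryUnits 𝔸).inv_mem hb₀)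

variable [Nontrivial 𝔸]

/-- **`Q(V₀, A, c) = (1∕i) log V̿₁(c)` IS SKEW** on Prop. 3's domain (`B7Prop3GeneralAnalytic.logDomainCov`: skew field with
`(2d+2)L·sup‖A‖ ≤ θ ≤ 1∕64`, unitary background with `α`-regular block contours, `α ≤ 1∕64`) once `‖Q‖ ≤ 1∕8` (then
`‖V̿₁ − 1‖ = ‖e^{Q} − 1‖ ≤ 1∕4` and (22)–(23) apply to the unitary `V̿₁(c)`). [cite: Balaban1985Averaging, (121) p.36, (22)–(23) p.21] -/
theorem star_Qcov_eq_neg (hL : 1 ≤ L) {V₀ : Site d → Fin d → 𝔸ˣ} (hV₀ : ∀ x κ, V₀ x κ ∈ unitaryUnits 𝔸)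
    {A : Site d → Fin d → 𝔸} (hAs : ∀ x κ, star (A x κ) = -A x κ) {a θ α : ℝ} (ha : 0 ≤ a) (hA : ∀ x κ, ‖A x κ‖ ≤ a)
    (hθ : ((2 * (d * L) + L + L : ℕ) : ℝ) * a ≤ θ) (hθ0 : 0 ≤ θ) (hθ1 : θ ≤ 1 / 64) (q : Site d) (κ : Fin d)
    (hα1 : α ≤ 1 / 64) (hreg : ∀ r : Fin d → Fin L, ‖((Wcx L V₀ q κ (boxVec L r) : 𝔸ˣ) : 𝔸) - 1‖ ≤ α)
    (hQ : ‖Qcov L V₀ A q κ‖ ≤ 1 / 8) : star (Qcov L V₀ A q κ) = -Qcov L V₀ A q κ := by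
  obtain ⟨hWc, hT₁, hT₂, hD⟩ := logDomainCov hL (fun x κ => unitaryUnits_le_U1 (hV₀ x κ)) A ha hA hθ hθ0 hθ1 q κ hα1 hreg
  have hunit := dbavgCov_mem_unitary (L := L) hV₀ hAs q κ (fun r => (hWc r).trans (by norm_num))
    (fun r => (hT₁ r).trans (by norm_num)) (fun r => (hT₂ r).trans (by norm_num))
    (fun r => (hreg r).trans (hα1.trans (by norm_num)))
  rw [mem_unitaryUnits] at hunit
  have hQdef : Qcov L V₀ A q κ = mlog ((dbavgCov L V₀ (expCfg A) q κ : 𝔸ˣ) : 𝔸) := rfl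
  -- `‖u − 1‖ = ‖e^{Q} − 1‖ ≤ e^{1/8} − 1 ≤ 1/4`
  have hexp := exp_mlog (hD.trans_lt (by norm_num))
  have h14 : ‖((dbavgCov L V₀ (expCfg A) q κ : 𝔸ˣ) : 𝔸) - 1‖ ≤ 1 / 4 := by
    rw [← hexp, ← hQdef]
    refine (B7Transfer.norm_exp_sub_one_le_of_le _ hQ).trans ?_
    have h := Real.exp_bound_div_one_sub_of_interval' (x := 1 / 8) (by norm_num) (by norm_num)
    have h87 : (1 : ℝ) / (1 - 1 / 8) = 8 / 7 := by norm_num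
    linarith
  rw [hQdef]
  exact star_mlog_eq_neg hunit h14

end DoubleBar

section Composite

variable {𝔸 : Type*} [CStarAlgebra 𝔸] [Nontrivial 𝔸] {L : ℕ}

variable (hL : 2 ≤ L) (k : ℕ) (U₀ : Site d → Fin d → 𝔸ˣ) (hU₀ : ∀ x κ, U₀ x κ ∈ unitaryUnits 𝔸) {α₀ : ℝ} (hα : 0 < α₀)
  (hα3 : C0 d * α₀ ≤ 1 / 3) (hα4 : 4 * α₀ ≤ c2' d L) (h52 : pdev U₀ < α₀ * (((L : ℝ) ^ k)⁻¹) ^ 2)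
include hL hU₀ hα hα3 hα4 h52

/-- the level-`j` averaged background is unitary with `1∕64`-regular block loops (Prop. 2 per level for `U(N)`:
`level_regularity` + `two_mul_le_betaMax` + `loopReg_of_pdev`). [cite: Balaban1985Averaging, Prop. 2 (54) p.26, p.37] -/
theorem level_unitary_loopReg {j : ℕ} (hj : j ≤ k) (q : Site d) (κ : Fin d) :
    (∀ x κ', avgIter L U₀ j x κ' ∈ unitaryUnits 𝔸) ∧ ∃ α : ℝ, α ≤ 1 / 64 ∧
      ∀ r : Fin d → Fin L, ‖((Wcx L (avgIter L U₀ j) q κ (boxVec L r) : 𝔸ˣ) : 𝔸) - 1‖ ≤ α := by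
  have hL1 : 1 ≤ L := le_trans (by norm_num) hL
  have hL1r : (1 : ℝ) ≤ L := by exact_mod_cast hL1
  have hα2 : 2 * α₀ ≤ c2' d L := by linarith
  obtain ⟨hpdev, hmem⟩ := level_regularity L hL (avgClosed_unitaryUnits d L) k U₀ hU₀ hα hα3 hα2 h52 j hj
  have hV : ∀ x κ', avgIter L U₀ j x κ' ∈ U1 𝔸 := fun x κ' => unitaryUnits_le_U1 (hmem x κ')
  have hLk : (0 : ℝ) < (L : ℝ) ^ k := by positivity
  have hratio : (L : ℝ) ^ j * ((L : ℝ) ^ k)⁻¹ ≤ 1 := by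
    rw [mul_inv_le_iff₀ hLk, one_mul]; exact pow_le_pow_right₀ hL1r hj
  have h1 : ((L : ℝ) ^ j * ((L : ℝ) ^ k)⁻¹) ^ 2 ≤ 1 := pow_le_one₀ (by positivity) hratio
  have hβmax : 2 * (α₀ * ((L : ℝ) ^ j * ((L : ℝ) ^ k)⁻¹) ^ 2)
      ≤ 1 / (1024 * ((d : ℝ) + 1) * ((d : ℝ) + 4) * (L : ℝ) ^ 2) := by
    have := two_mul_le_betaMax (d := d) hα4
    nlinarith [mul_le_mul_of_nonneg_left h1 hα.le]
  obtain ⟨hreg, hsmall⟩ := loopReg_of_pdev hL1 hV (by positivity) hpdev hβmax q κ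
  exact ⟨hmem, _, hsmall, hreg⟩

/-- **THE COMPOSITE IS SKEW-VALUED**: for a skew initial field `B` with `sup‖B‖ ≤ b` in Prop. 4's regime ((131)'s bracket
`e^{4·O1cov·α₀}(1 + 8·C1cov·Lᵏb) ≤ 2`, «α₁ ≦ ½c₃» as `2Lᵏb ≤ c₃(d,L)`), every `Q_j(U₀, B)(c)`, `j ≤ k`, is skew-adjoint —
induction on `j` with `star_Qcov_eq_neg` at the unitary level background `Ū₀ʲ`, the sup bound `‖Q_j‖ ≤ 2Lʲb` ((131)) of
`prop4_general_bounds` supplying both Prop. 3's domain and `‖Q_{j+1}‖ ≤ c₃ ≤ 1∕8`. [cite: Balaban1985Averaging, (127) p.37, (131) p.38] -/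
theorem logCovIter_mem_skew (B : Site d → Fin d → 𝔸) (hBs : ∀ x κ, star (B x κ) = -B x κ) {b : ℝ} (hb : 0 ≤ b)
    (hB : ∀ x κ, ‖B x κ‖ ≤ b) (hsmall : Real.exp (4 * O1cov d * α₀) * (1 + 8 * C1cov d * ((L : ℝ) ^ k * b)) ≤ 2)
    (hc₃ : 2 * ((L : ℝ) ^ k * b) ≤ c3 d L) :
    ∀ j ≤ k, ∀ (z : Site d) (κ : Fin d), star (logCovIter L U₀ B j z κ) = -logCovIter L U₀ B j z κ := by
  have hL1 : 1 ≤ L := le_trans (by norm_num) hL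
  have hL1r : (1 : ℝ) ≤ L := by exact_mod_cast hL1
  have hbounds := prop4_general_bounds L hL (avgClosed_unitaryUnits d L) k U₀ hU₀ hα hα3 hα4 h52 B hb hB hsmall hc₃
  have hc3val : c3 d L = 1 / (128 * ((d : ℝ) + 1) * L) := rfl
  have hc3le : c3 d L ≤ 1 / 8 := by
    rw [hc3val]
    have hL2 : (2 : ℝ) ≤ L := by exact_mod_cast hL
    exact one_div_le_one_div_of_le (by norm_num) (by nlinarith [(Nat.cast_nonneg d : (0 : ℝ) ≤ d)])
  intro j
  induction j with
  | zero => intro _ z κ; rw [logCovIter_zero]; exact hBs z κ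
  | succ j ih =>
    intro hj z κ
    have hjk : j ≤ k := Nat.le_of_succ_le hj
    -- sup bound of the level-`j` field and of the next composite
    have hLj : (L : ℝ) ^ j * b ≤ (L : ℝ) ^ k * b :=
      mul_le_mul_of_nonneg_right (pow_le_pow_right₀ hL1r hjk) hb
    have hLj1 : (L : ℝ) ^ (j + 1) * b ≤ (L : ℝ) ^ k * b :=
      mul_le_mul_of_nonneg_right (pow_le_pow_right₀ hL1r hj) hb
    set a : ℝ := 2 * ((L : ℝ) ^ j * b) with ha_def
    have ha0 : 0 ≤ a := by positivity
    have hac3 : a ≤ c3 d L := by rw [ha_def]; linarith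
    have hA : ∀ x κ', ‖logCovIter L U₀ B j x κ'‖ ≤ a := (hbounds j hjk).2
    have hQ : ‖logCovIter L U₀ B (j + 1) z κ‖ ≤ 1 / 8 :=
      ((hbounds (j + 1) hj).2 z κ).trans (by linarith)
    -- Prop. 3's domain: `(2d+2)L·a ≤ 1/64` from `a ≤ c₃ = 1/(128(d+1)L)`
    have hθ : ((2 * (d * L) + L + L : ℕ) : ℝ) * a ≤ 1 / 64 := by
      have hcast : ((2 * (d * L) + L + L : ℕ) : ℝ) = 2 * ((d : ℝ) + 1) * L := by push_cast; ring
      rw [hcast]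
      have hpos : (0 : ℝ) < 128 * ((d : ℝ) + 1) * L := by positivity
      have h1 : a * (128 * ((d : ℝ) + 1) * L) ≤ 1 := by
        have := mul_le_mul_of_nonneg_right hac3 hpos.le
        rwa [hc3val, one_div, inv_mul_cancel₀ hpos.ne'] at this
      nlinarith
    obtain ⟨hV, α, hα1, hreg⟩ := level_unitary_loopReg hL k U₀ hU₀ hα hα3 hα4 h52 hjk ((L : ℤ) • z) κ
    rw [logCovIter_succ]
    exact star_Qcov_eq_neg hL1 hV (fun x κ' => ih hjk x κ') ha0 hA hθ (by norm_num) le_rfl ((L : ℤ) • z) κ hα1 hreg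
      (by rw [← logCovIter_succ]; exact hQ)

end Composite

section Real

/-- [folklore] if `f` has Fréchet derivative `T` at `0`, `f 0 = 0`, and `f(tA) ∈ K` for small real `t ≠ 0`, `K` a closed
additive subgroup stable under real scalars, then `T A ∈ K` (the real-ray difference quotients lie in `K` and tend to `T A`). -/
theorem mem_of_hasFDerivAt_real_ray {𝒴 𝒳 : Type*} [NormedAddCommGroup 𝒴] [NormedSpace ℂ 𝒴] [NormedAddCommGroup 𝒳]
    [NormedSpace ℂ 𝒳] {f : 𝒴 → 𝒳} {T : 𝒴 →L[ℂ] 𝒳} (hf : HasFDerivAt f T 0) (hf0 : f 0 = 0) (K : AddSubgroup 𝒳)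
    (hK : IsClosed (K : Set 𝒳)) (hKsmul : ∀ (r : ℝ) (x : 𝒳), x ∈ K → (r : ℂ) • x ∈ K) (A : 𝒴)
    (hA : ∀ᶠ t : ℝ in 𝓝[≠] 0, f ((t : ℂ) • A) ∈ K) : T A ∈ K := by
  -- the real ray and its derivative
  have hray : HasDerivAt (fun t : ℝ => (t : ℂ) • A) A 0 := by
    have h := (hasDerivAt_id' (0 : ℝ)).smul_const A
    simp only [one_smul] at h
    simpa only [Complex.coe_smul] using h
  have hf' : HasFDerivAt f (T.restrictScalars ℝ) ((fun t : ℝ => (t : ℂ) • A) 0) := by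
    simpa only [Complex.ofReal_zero, zero_smul] using hf.restrictScalars ℝ
  have hg : HasDerivAt (f ∘ fun t : ℝ => (t : ℂ) • A) (T.restrictScalars ℝ A) 0 := hf'.comp_hasDerivAt (0 : ℝ) hray
  rw [hasDerivAt_iff_tendsto_slope] at hg
  have hmem : ∀ᶠ t : ℝ in 𝓝[≠] 0, slope (f ∘ fun t : ℝ => (t : ℂ) • A) 0 t ∈ (K : Set 𝒳) := by
    filter_upwards [hA] with t ht
    rw [slope_def_module, Function.comp_apply, Function.comp_apply, Complex.ofReal_zero, zero_smul, hf0, sub_zero,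
      sub_zero, ← Complex.coe_smul]
    exact hKsmul _ _ ht
  exact hK.mem_of_tendsto hg hmem

variable {𝔸 : Type*} [CStarAlgebra 𝔸] [Nontrivial 𝔸] {L : ℕ}

variable (hL : 2 ≤ L) (k : ℕ) (U₀ : Site d → Fin d → 𝔸ˣ) (hU₀ : ∀ x κ, U₀ x κ ∈ unitaryUnits 𝔸) {α₀ : ℝ} (hα : 0 < α₀)
  (hα3 : C0 d * α₀ ≤ 1 / 3) (hα4 : 4 * α₀ ≤ c2' d L) (hα6 : 4 * O1cov d * α₀ ≤ 1 / 3)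
  (h52 : pdev U₀ < α₀ * (((L : ℝ) ^ k)⁻¹) ^ 2) (S S' : Finset (Site d × Fin d))
include hL hU₀ hα hα3 hα4 hα6 h52

/-- **THE COMPOSITE `A ↦ Q_k(U₀, ηA)` ON `𝔸^S` MAPS SKEW FIELDS IN THE BALL TO SKEW FIELDS** (§3 at the scaled insertion
`ηA`, `Lᵏ·(η‖A‖) = ‖A‖ < landauRad`). [cite: Balaban1985Averaging, (127) p.37, Proposition 4 p.38] -/
theorem logCovIter_scaleIns_mem_skewPi {A : ↥S → 𝔸} (hAs : A ∈ skewPi ↥S) (hA : ‖A‖ < landauRad d L) :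
    (fun c : ↥S' => logCovIter L U₀ (scaleIns L k S A) k c.1.1 c.1.2) ∈ skewPi ↥S' := by
  have hL1 : 1 ≤ L := le_trans (by norm_num) hL
  rw [mem_skewPi] at hAs ⊢
  obtain ⟨h8, hc₃⟩ := bracket_of_le_landauRad (d := d) hA.le
  obtain ⟨_, hsmall⟩ := smallness_of_bracket (d := d) hα hα6 (norm_nonneg A) h8
  have hBs : ∀ x κ, star (scaleIns L k S A x κ) = -scaleIns L k S A x κ := by
    intro x κ
    unfold scaleIns insCfg
    by_cases h : (x, κ) ∈ S
    · simp only [dif_pos h, Pi.smul_apply]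
      have hr : ((L : ℂ) ^ k)⁻¹ = (((((L : ℝ) ^ k)⁻¹ : ℝ)) : ℂ) := by push_cast; rfl
      rw [hr]
      have := real_smul_mem_skewAdjoint (((L : ℝ) ^ k)⁻¹) (skewAdjoint.mem_iff.2 (hAs ⟨(x, κ), h⟩))
      exact skewAdjoint.mem_iff.1 this
    · simp only [dif_neg h, star_zero, neg_zero]
  intro c
  have h := logCovIter_mem_skew hL k U₀ hU₀ hα hα3 hα4 h52 (scaleIns L k S A) hBs (by positivity)
    (norm_scaleIns_le L k S A) (by rwa [pow_mul_inv_mul hL1]) (by rwa [pow_mul_inv_mul hL1]) k le_rfl c.1.1 c.1.2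
  exact h

/-- **THE COMPOSED LINEAR PART «LᵏηQ_k(U₀)A» IS SKEW FOR SKEW `A`** (all `A ∈ skewPi S`: it is linear): it IS the Fréchet
derivative at `0` of `A ↦ Q_k(U₀, ηA)` (S64b's `hasFDerivAt_zero_of_sq_bound` with S64's `norm_landauCf_le` and
`isBoundedLinearMap_landauLin`), whose real-ray difference quotients are skew by `logCovIter_scaleIns_mem_skewPi`.
[cite: Balaban1985Averaging, (134) p.38] -/
theorem landauLin_mem_skewPi {A : ↥S → 𝔸} (hAs : A ∈ skewPi ↥S) : landauLin L U₀ k S S' A ∈ skewPi ↥S' := by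
  have hL1 : 1 ≤ L := le_trans (by norm_num) hL
  obtain ⟨hblm, _⟩ := isBoundedLinearMap_landauLin L hL (avgClosed_unitaryUnits d L) k U₀ hU₀ hα hα3 hα4 h52 hα6 S S'
  set T : (↥S → 𝔸) →L[ℂ] (↥S' → 𝔸) := hblm.toContinuousLinearMap with hT
  have hTapp : ∀ B, T B = landauLin L U₀ k S S' B := fun B => rfl
  set Qk : (↥S → 𝔸) → (↥S' → 𝔸) := fun B c => logCovIter L U₀ (scaleIns L k S B) k c.1.1 c.1.2 with hQk
  have hrad := landauRad_pos d hL1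
  have hsq : ∀ B ∈ ball (0 : ↥S → 𝔸) (landauRad d L), ‖Qk B - T B‖ ≤ C2cov d * ‖B‖ ^ 2 := fun B hB =>
    norm_landauCf_le L hL (avgClosed_unitaryUnits d L) k U₀ hU₀ hα hα3 hα4 hα6 h52 S S' (mem_ball_zero_iff.1 hB).le
  have hQ : HasFDerivAt Qk T 0 := hasFDerivAt_zero_of_sq_bound hrad hsq
  have hQ0 : Qk 0 = 0 := by
    simpa [norm_le_zero_iff] using hsq 0 (mem_ball_self hrad)
  have hmem : ∀ᶠ t : ℝ in 𝓝[≠] 0, Qk ((t : ℂ) • A) ∈ skewPi ↥S' := by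
    have hball : ∀ᶠ t : ℝ in 𝓝[≠] (0 : ℝ), ‖(t : ℂ) • A‖ < landauRad d L := by
      have hcont : Tendsto (fun t : ℝ => ‖(t : ℂ) • A‖) (𝓝 0) (𝓝 0) := by
        have h := ((Complex.continuous_ofReal.tendsto 0).smul_const A).norm
        simpa only [Complex.ofReal_zero, zero_smul, norm_zero] using h
      exact nhdsWithin_le_nhds (hcont.eventually (gt_mem_nhds hrad))
    filter_upwards [hball] with t ht
    exact logCovIter_scaleIns_mem_skewPi hL k U₀ hU₀ hα hα3 hα4 hα6 h52 S S' (real_smul_mem_skewPi t hAs) ht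
  exact mem_of_hasFDerivAt_real_ray hQ hQ0 (skewPi ↥S') (isClosed_skewPi _) (fun r x hx => real_smul_mem_skewPi r hx)
    A hmem

/-- **`hCr` ON THE BALL — THE LANDAU CORRECTION MAPS REAL (SKEW) FIELDS TO REAL (SKEW) FIELDS**: for `A ∈ skewPi S` with
`‖A‖ < landauRad d L`, `landauCf L U₀ k S S' A ∈ skewPi S'` (`C_k = Q_k − LᵏηQ_k`, both skew). [cite: Balaban1985Averaging, (134) p.38] -/
theorem landauCf_mem_skewPi {A : ↥S → 𝔸} (hAs : A ∈ skewPi ↥S) (hA : ‖A‖ < landauRad d L) :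
    landauCf L U₀ k S S' A ∈ skewPi ↥S' := by
  have hQ := logCovIter_scaleIns_mem_skewPi hL k U₀ hU₀ hα hα3 hα4 hα6 h52 S S' hAs hA
  have hLin := landauLin_mem_skewPi hL k U₀ hU₀ hα hα3 hα4 hα6 h52 S S' hAs
  have h := (skewPi ↥S').sub_mem hQ hLin
  have heq : landauCf L U₀ k S S' A
      = (fun c : ↥S' => logCovIter L U₀ (scaleIns L k S A) k c.1.1 c.1.2) - landauLin L U₀ k S S' A := by
    funext c; rfl
  rw [heq]; exact h

/-- **`landauCorrection_real_binders` — `hCq`, `hCd`, `hCr` (+ `h𝓡𝒳`) FOR ONE MAP**, the cut-off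
`CfR := (ball 0 (landauRad d L)).indicator (landauCf L U₀ k S S')` (= `landauCf` on the ball where END-II evaluates it, `0`
outside, S64b's device), with the real structure `𝓡𝒴' := skewPi S`, `𝓡𝒳 := skewPi S'`: quadratic bound `C2cov d` and
differentiability on `ball 0 (landauRad d L)` from S64 (main)'s `norm_landauCf_le`∕`differentiableOn_landauCf`, reality GLOBAL
in `Z`, `skewPi S'` closed — for a UNITARY background `U₀` under print's (52) and «α₀ ≤ c₂»-type smallness (S64's hypotheses).
[cite: Balaban1985Averaging, Proposition 4 (134)–(135) pp.38–39; Balaban1985Variational, (44) p.285] -/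
theorem landauCorrection_real_binders :
    (∀ Z : ↥S → 𝔸, ‖Z‖ < landauRad d L →
        ‖(ball (0 : ↥S → 𝔸) (landauRad d L)).indicator (landauCf L U₀ k S S') Z‖ ≤ C2cov d * ‖Z‖ ^ 2) ∧
      DifferentiableOn ℂ ((ball (0 : ↥S → 𝔸) (landauRad d L)).indicator (landauCf L U₀ k S S'))
        (ball 0 (landauRad d L)) ∧
      (∀ Z ∈ skewPi ↥S, (ball (0 : ↥S → 𝔸) (landauRad d L)).indicator (landauCf L U₀ k S S') Z ∈ skewPi ↥S') ∧
      IsClosed ((skewPi (𝔸 := 𝔸) ↥S' : AddSubgroup (↥S' → 𝔸)) : Set (↥S' → 𝔸)) := by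
  have hG := avgClosed_unitaryUnits d L (𝔸 := 𝔸)
  have heqOn : EqOn ((ball (0 : ↥S → 𝔸) (landauRad d L)).indicator (landauCf L U₀ k S S')) (landauCf L U₀ k S S')
      (ball 0 (landauRad d L)) := fun Z hZ => Set.indicator_of_mem hZ _
  refine ⟨fun Z hZ => ?_, ?_, fun Z hZs => ?_, isClosed_skewPi _⟩
  · rw [Set.indicator_of_mem (mem_ball_zero_iff.2 hZ)]
    exact norm_landauCf_le L hL hG k U₀ hU₀ hα hα3 hα4 hα6 h52 S S' hZ.le
  · exact (differentiableOn_landauCf L hL hG k U₀ hU₀ hα hα3 hα4 hα6 h52 S S').congr heqOn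
  · by_cases hZ : Z ∈ ball (0 : ↥S → 𝔸) (landauRad d L)
    · rw [Set.indicator_of_mem hZ]
      exact landauCf_mem_skewPi hL k U₀ hU₀ hα hα3 hα4 hα6 h52 S S' hZs (mem_ball_zero_iff.1 hZ)
    · rw [Set.indicator_of_notMem hZ]
      exact (skewPi ↥S').zero_mem

end Real

end Summit.QuantumFields.BalabanUV.T4Continuum.ShellMeasureLandauCorrectionReal

end
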